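import Mathlib
import Summits.AnomalousDissipation.AnomalousDissipation.Theses.PointSink
import Literature.Analysis.FluidPDE.WholeSpaceIBP
import Summits.AnomalousDissipation.AnomalousDissipation.Theorems.PointFluxCone.Negative.ClassicalFluxRigidity

/-!
# No `C¹` witness of `PointSink.PointFluxCone` (stmt-AnomalousDissipation-19033) — the crux's
roughness is load-bearing

Refuter (cdisprove) record for route `AnomalousDissipation/PointSink`, companion of
`ClassicalFluxRigidity.lean`. That file refutes the CLASSICAL strengthening of the crux (pointwise
steady Euler off the origin). This file closes the gap to the crux AS TYPED: its weak clauses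
(momentum against smooth vector tests supported off the origin with explicit pressure, weak
divergence-freeness) turn a `C¹`-off-the-origin pair into a classical one, so

* `not_exists_pointFluxCone_contDiffOn` — the body of `PointSink.PointFluxCone` VERBATIM with the
  two extra clauses `ContDiffOn ℝ 1 V {x ≠ 0}`, `ContDiffOn ℝ 1 P {x ≠ 0}` is FALSE;
* `pointFluxCone_witness_not_contDiffOn` — every triple `(λ, V, P)` satisfying the crux's clauses
  has `V` or `P` not of class `C¹` on `ℝ³ ∖ {0}`.

Ingredients (folklore): `∫ θ div W + ∫ ⟪W, ∇θ⟫ = 0` off the origin (radial cut-off + the tree's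
whole-space identity), the tree's trilinear and pressure identities for the globalised fields,
Mathlib's fundamental lemma `IsOpen.ae_eq_zero_of_integral_contDiff_smul_eq_zero`, continuity.

For a prover of the crux: the witness must be rough in the bulk of every shell (renormalised
Bernoulli transport must fail there); singular only at the origin is impossible. [folklore]
-/

set_option linter.dupNamespace false  -- `Summit.AnomalousDissipation.AnomalousDissipation` is the mandated summit/problem namespace

noncomputable section

open MeasureTheory Metric Filter Topology Set Function
open scoped InnerProductSpace RealInnerProductSpace ContDiff
open Literature.Analysis.FluidPDE

namespace Summit.AnomalousDissipation.AnomalousDissipation.Theorems.PointFluxCone.Negative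

section WeakToClassical

variable {V : EuclideanSpace ℝ (Fin 3) → EuclideanSpace ℝ (Fin 3)} {P : EuclideanSpace ℝ (Fin 3) → ℝ}

/-- A continuous function on an open set which vanishes almost everywhere there vanishes
everywhere there. [folklore] -/
theorem eq_zero_of_ae_of_continuousOn {f : EuclideanSpace ℝ (Fin 3) → ℝ}
    {U : Set (EuclideanSpace ℝ (Fin 3))} (hU : IsOpen U) (hf : ContinuousOn f U)
    (h : ∀ᵐ x ∂(volume : Measure (EuclideanSpace ℝ (Fin 3))), x ∈ U → f x = 0) :
    ∀ x ∈ U, f x = 0 := by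
  intro x hx
  by_contra hfx
  have hpos : 0 < |f x| := abs_pos.2 hfx
  obtain ⟨δ₁, hδ₁, hball₁⟩ := Metric.isOpen_iff.1 hU x hx
  obtain ⟨δ₂, hδ₂, hcont⟩ := Metric.continuousAt_iff.1 (hf.continuousAt (hU.mem_nhds hx))
    (|f x| / 2) (half_pos hpos)
  have hsub : Metric.ball x (min δ₁ δ₂) ⊆ {y | ¬ (y ∈ U → f y = 0)} := by
    intro y hy
    rw [Metric.mem_ball] at hy
    have hyU : y ∈ U := hball₁ (Metric.mem_ball.2 (lt_of_lt_of_le hy (min_le_left _ _)))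
    have hfy : dist (f y) (f x) < |f x| / 2 := hcont (lt_of_lt_of_le hy (min_le_right _ _))
    simp only [mem_setOf_eq, Classical.not_imp]
    refine ⟨hyU, fun h0 => ?_⟩
    rw [h0, Real.dist_eq, zero_sub, abs_neg] at hfy
    linarith
  have hnull : volume {y : EuclideanSpace ℝ (Fin 3) | ¬ (y ∈ U → f y = 0)} = 0 := ae_iff.1 h
  exact absurd (measure_mono_null hsub hnull) (Metric.measure_ball_pos volume x (lt_min hδ₁ hδ₂)).ne'

/-- **`∫ θ div W + ∫ ⟪W, ∇θ⟫ = 0` off the origin**: for `W ∈ C¹(ℝ³ ∖ {0})` and a `C¹_c` test `θ`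
vanishing near the origin (cut-off globalisation of the tree's whole-space identity). [folklore] -/
theorem integral_mul_divergence_add_off_zero
    {W : EuclideanSpace ℝ (Fin 3) → EuclideanSpace ℝ (Fin 3)} {θ : EuclideanSpace ℝ (Fin 3) → ℝ}
    (hW : ContDiffOn ℝ 1 W {x | x ≠ 0}) (hθ : ContDiff ℝ 1 θ) (hθc : HasCompactSupport θ)
    (hθ0 : (0 : EuclideanSpace ℝ (Fin 3)) ∉ tsupport θ) :
    (∫ x, θ x * VectorCalculus.divergence W x) + ∫ x, ⟪W x, gradient θ x⟫ = 0 := by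
  obtain ⟨ε, hε, hball⟩ := Metric.isOpen_iff.1 (isClosed_tsupport θ).isOpen_compl 0 hθ0
  -- smooth radial cut-off and globalised field
  set χ : EuclideanSpace ℝ (Fin 3) → ℝ :=
    fun x => Real.smoothTransition (4 * ‖x‖ ^ 2 / ε ^ 2 - 1) with hχ
  have hχC : ContDiff ℝ 1 χ := by
    have h1 : ContDiff ℝ 1 (fun x : EuclideanSpace ℝ (Fin 3) => 4 * ‖x‖ ^ 2 / ε ^ 2 - 1) :=
      ((contDiff_const.mul (contDiff_norm_sq ℝ)).div_const _).sub contDiff_const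
    exact (Real.smoothTransition.contDiff (n := 1)).comp h1
  have hχ0 : ∀ x : EuclideanSpace ℝ (Fin 3), ‖x‖ ≤ ε / 2 → χ x = 0 := fun x hx => by
    refine Real.smoothTransition.zero_of_nonpos ?_
    rw [sub_nonpos, div_le_one (by positivity)]
    nlinarith [norm_nonneg x]
  have hχ1 : ∀ x : EuclideanSpace ℝ (Fin 3), ε ^ 2 / 2 ≤ ‖x‖ ^ 2 → χ x = 1 := fun x hx => by
    refine Real.smoothTransition.one_of_one_le ?_
    rw [le_sub_iff_add_le, le_div_iff₀ (by positivity)]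
    linarith
  set U : EuclideanSpace ℝ (Fin 3) → EuclideanSpace ℝ (Fin 3) := fun x => χ x • W x with hU
  have hUC : ContDiff ℝ 1 U := by
    rw [contDiff_iff_contDiffAt]
    intro x
    by_cases hx : ‖x‖ < ε / 2
    · have hev : U =ᶠ[𝓝 x] fun _ => 0 := by
        filter_upwards [(isOpen_lt continuous_norm continuous_const).mem_nhds hx] with y hy
        simp [hU, hχ0 y (le_of_lt hy)]
      exact contDiffAt_const.congr_of_eventuallyEq hev
    · have hx0 : x ≠ 0 := by
        intro h; apply hx; rw [h, norm_zero]; positivity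
      exact (hχC.contDiffAt).smul (hW.contDiffAt (isOpen_ne.mem_nhds hx0))
  have hUW : ∀ x : EuclideanSpace ℝ (Fin 3), ε ≤ ‖x‖ → U =ᶠ[𝓝 x] W := by
    intro x hx
    have hlt : ε ^ 2 / 2 < ‖x‖ ^ 2 := by nlinarith
    filter_upwards [(isOpen_lt continuous_const (continuous_norm.pow 2)).mem_nhds hlt] with y hy
    simp [hU, hχ1 y (le_of_lt hy)]
  have key := integral_mul_divergence_add_eq_zero_left hθ hUC hθc
  have h1 : (fun x => θ x * VectorCalculus.divergence U x) =
      fun x => θ x * VectorCalculus.divergence W x := by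
    funext x
    by_cases hx : ‖x‖ < ε
    · have hxs : x ∉ tsupport θ := fun h => hball (by simpa using hx) h
      rw [image_eq_zero_of_notMem_tsupport hxs, zero_mul, zero_mul]
    · have hx' : ε ≤ ‖x‖ := not_lt.1 hx
      simp only [VectorCalculus.divergence, (hUW x hx').fderiv_eq]
  have h2 : (fun x => ⟪U x, gradient θ x⟫) = fun x => ⟪W x, gradient θ x⟫ := by
    funext x
    by_cases hx : ‖x‖ < ε
    · have hxs : x ∉ tsupport θ := fun h => hball (by simpa using hx) h
      rw [gradient_eq_zero_of_notMem_tsupport hxs, inner_zero_right, inner_zero_right]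
    · have hx' : ε ≤ ‖x‖ := not_lt.1 hx
      rw [show U x = W x from (hUW x hx').self_of_nhds]
  rw [h1, h2] at key
  exact key

/-- **Weak ⇒ classical, divergence.** A field that is `C¹` off the origin and weakly divergence
free against all smooth tests supported off the origin is divergence free pointwise off the
origin (integration by parts + the fundamental lemma of the calculus of variations + continuity).
[folklore] -/
theorem divergence_eq_zero_of_weak (hV : ContDiffOn ℝ 1 V {x | x ≠ 0})
    (hweak : ∀ θ : EuclideanSpace ℝ (Fin 3) → ℝ,
      Literature.Analysis.FunctionSpaces.IsTestFunctionOn ⟨{x | x ≠ 0}, isOpen_ne⟩ θ →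
        ∫ x, ⟪V x, gradient θ x⟫ = 0) :
    ∀ x : EuclideanSpace ℝ (Fin 3), x ≠ 0 → VectorCalculus.divergence V x = 0 := by
  have hcont : ContinuousOn (VectorCalculus.divergence V) {x | x ≠ 0} := by
    have hfd : ContinuousOn (fun y => fderiv ℝ V y) {x | x ≠ 0} :=
      hV.continuousOn_fderiv_of_isOpen isOpen_ne le_rfl
    have : VectorCalculus.divergence V = fun y => ∑ i, ⟪EuclideanSpace.basisFun (Fin 3) ℝ i,
        fderiv ℝ V y (EuclideanSpace.basisFun (Fin 3) ℝ i)⟫ :=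
      funext (divergence_eq_sum_inner_fderiv (EuclideanSpace.basisFun (Fin 3) ℝ) V)
    rw [this]
    exact continuousOn_finsetSum _ fun i _ =>
      continuousOn_const.inner (hfd.clm_apply continuousOn_const)
  have hae : ∀ᵐ x ∂(volume : Measure (EuclideanSpace ℝ (Fin 3))),
      x ∈ {x : EuclideanSpace ℝ (Fin 3) | x ≠ 0} → VectorCalculus.divergence V x = 0 := by
    refine isOpen_ne.ae_eq_zero_of_integral_contDiff_smul_eq_zero
      (hcont.locallyIntegrableOn isOpen_ne.measurableSet) fun g hg hgc hgs => ?_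
    have htest : Literature.Analysis.FunctionSpaces.IsTestFunctionOn
        (⟨{x | x ≠ 0}, isOpen_ne⟩ : TopologicalSpace.Opens (EuclideanSpace ℝ (Fin 3))) g :=
      ⟨hg, hgc, hgs⟩
    have hg0 : (0 : EuclideanSpace ℝ (Fin 3)) ∉ tsupport g := fun h => by simpa using hgs h
    have h := integral_mul_divergence_add_off_zero hV (hg.of_le (by exact_mod_cast le_top)) hgc hg0
    rw [hweak g htest, add_zero] at h
    simpa [smul_eq_mul] using h
  exact fun x hx => eq_zero_of_ae_of_continuousOn isOpen_ne hcont hae x hx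

/-- **Weak ⇒ classical, momentum.** If `(V, P)` is `C¹` off the origin, divergence free there,
and satisfies the crux's weak momentum equation against all smooth vector tests supported off
the origin, then `(V·∇)V + ∇P = 0` pointwise off the origin. [folklore] -/
theorem momentum_eq_zero_of_weak (hV : ContDiffOn ℝ 1 V {x | x ≠ 0})
    (hP : ContDiffOn ℝ 1 P {x | x ≠ 0})
    (hdiv : ∀ x : EuclideanSpace ℝ (Fin 3), x ≠ 0 → VectorCalculus.divergence V x = 0)
    (hweak : ∀ φ : EuclideanSpace ℝ (Fin 3) → EuclideanSpace ℝ (Fin 3),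
      Literature.Analysis.FunctionSpaces.IsTestFunctionOn ⟨{x | x ≠ 0}, isOpen_ne⟩ φ →
        ∫ x, (⟪V x, fderiv ℝ φ x (V x)⟫ + P x * VectorCalculus.divergence φ x) = 0) :
    ∀ x : EuclideanSpace ℝ (Fin 3), x ≠ 0 → convect V V x + gradient P x = 0 := by
  -- Step 1: `∫ ⟪(V·∇)V + ∇P, φ⟫ = 0` for every vector test `φ` off the origin
  have hG : ∀ φ : EuclideanSpace ℝ (Fin 3) → EuclideanSpace ℝ (Fin 3),
      Literature.Analysis.FunctionSpaces.IsTestFunctionOn ⟨{x | x ≠ 0}, isOpen_ne⟩ φ →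
        ∫ x, ⟪convect V V x + gradient P x, φ x⟫ = 0 := by
    intro φ hφ
    have hφC : ContDiff ℝ 1 φ := hφ.contDiff.of_le (by exact_mod_cast le_top)
    have hφc : HasCompactSupport φ := hφ.hasCompactSupport
    have hφ0 : (0 : EuclideanSpace ℝ (Fin 3)) ∉ tsupport φ := fun h => by
      simpa using hφ.tsupport_subset h
    obtain ⟨ε, hε, hball⟩ := Metric.isOpen_iff.1 (isClosed_tsupport φ).isOpen_compl 0 hφ0
    -- cut-off and globalised fields
    set χ : EuclideanSpace ℝ (Fin 3) → ℝ :=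
      fun x => Real.smoothTransition (4 * ‖x‖ ^ 2 / ε ^ 2 - 1) with hχ
    have hχC : ContDiff ℝ 1 χ := by
      have h1 : ContDiff ℝ 1 (fun x : EuclideanSpace ℝ (Fin 3) => 4 * ‖x‖ ^ 2 / ε ^ 2 - 1) :=
        ((contDiff_const.mul (contDiff_norm_sq ℝ)).div_const _).sub contDiff_const
      exact (Real.smoothTransition.contDiff (n := 1)).comp h1
    have hχ0 : ∀ x : EuclideanSpace ℝ (Fin 3), ‖x‖ ≤ ε / 2 → χ x = 0 := fun x hx => by
      refine Real.smoothTransition.zero_of_nonpos ?_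
      rw [sub_nonpos, div_le_one (by positivity)]
      nlinarith [norm_nonneg x]
    have hχ1 : ∀ x : EuclideanSpace ℝ (Fin 3), ε ^ 2 / 2 ≤ ‖x‖ ^ 2 → χ x = 1 := fun x hx => by
      refine Real.smoothTransition.one_of_one_le ?_
      rw [le_sub_iff_add_le, le_div_iff₀ (by positivity)]
      linarith
    set U : EuclideanSpace ℝ (Fin 3) → EuclideanSpace ℝ (Fin 3) := fun x => χ x • V x with hU
    set Q : EuclideanSpace ℝ (Fin 3) → ℝ := fun x => χ x * P x with hQ
    have hloc0 : ∀ x : EuclideanSpace ℝ (Fin 3), ‖x‖ < ε / 2 →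
        (U =ᶠ[𝓝 x] fun _ => 0) ∧ (Q =ᶠ[𝓝 x] fun _ => 0) := by
      intro x hx
      constructor <;>
      · filter_upwards [(isOpen_lt continuous_norm continuous_const).mem_nhds hx] with y hy
        simp [hU, hQ, hχ0 y (le_of_lt hy)]
    have hUC : ContDiff ℝ 1 U := by
      rw [contDiff_iff_contDiffAt]
      intro x
      by_cases hx : ‖x‖ < ε / 2
      · exact contDiffAt_const.congr_of_eventuallyEq (hloc0 x hx).1
      · have hx0 : x ≠ 0 := by
          intro h; apply hx; rw [h, norm_zero]; positivity
        exact (hχC.contDiffAt).smul (hV.contDiffAt (isOpen_ne.mem_nhds hx0))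
    have hQC : ContDiff ℝ 1 Q := by
      rw [contDiff_iff_contDiffAt]
      intro x
      by_cases hx : ‖x‖ < ε / 2
      · exact contDiffAt_const.congr_of_eventuallyEq (hloc0 x hx).2
      · have hx0 : x ≠ 0 := by
          intro h; apply hx; rw [h, norm_zero]; positivity
        exact (hχC.contDiffAt).mul (hP.contDiffAt (isOpen_ne.mem_nhds hx0))
    have hUV : ∀ x : EuclideanSpace ℝ (Fin 3), ε ≤ ‖x‖ → (U =ᶠ[𝓝 x] V) ∧ (Q =ᶠ[𝓝 x] P) := by
      intro x hx
      have hlt : ε ^ 2 / 2 < ‖x‖ ^ 2 := by nlinarith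
      constructor <;>
      · filter_upwards [(isOpen_lt continuous_const (continuous_norm.pow 2)).mem_nhds hlt]
          with y hy
        simp [hU, hQ, hχ1 y (le_of_lt hy)]
    -- off the ball of radius `ε` the test and its derivative vanish
    have hφ_zero : ∀ x : EuclideanSpace ℝ (Fin 3), ‖x‖ < ε → φ x = 0 ∧ fderiv ℝ φ x = 0 := by
      intro x hx
      have hxs : x ∉ tsupport φ := fun h => hball (by simpa using hx) h
      exact ⟨image_eq_zero_of_notMem_tsupport hxs, fderiv_of_notMem_tsupport ℝ hxs⟩
    -- the tree's identities for the globalised fields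
    have htri := integral_inner_convect_add_eq_zero hUC hUC hφC hφc
    have hpr := integral_inner_gradient_eq_neg_integral_mul_divergence hQC hφC hφc
    -- pointwise identifications
    have e1 : (fun x => ⟪U x, convect U φ x⟫) = fun x => ⟪V x, fderiv ℝ φ x (V x)⟫ := by
      funext x
      by_cases hx : ‖x‖ < ε
      · simp [convect, (hφ_zero x hx).2]
      · have hx' := (hUV x (not_lt.1 hx)).1.self_of_nhds
        simp [convect, hx']
    have e2 : (fun x => VectorCalculus.divergence U x * ⟪U x, φ x⟫) = fun _ => 0 := by
      funext x
      by_cases hx : ‖x‖ < ε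
      · simp [(hφ_zero x hx).1]
      · have hx' : ε ≤ ‖x‖ := not_lt.1 hx
        have hx0 : x ≠ 0 := by
          intro h; rw [h, norm_zero] at hx'; exact absurd hx' (not_le.2 hε)
        have : VectorCalculus.divergence U x = VectorCalculus.divergence V x := by
          simp only [VectorCalculus.divergence, (hUV x hx').1.fderiv_eq]
        rw [this, hdiv x hx0, zero_mul]
    have e3 : (fun x => ⟪convect U U x, φ x⟫) = fun x => ⟪convect V V x, φ x⟫ := by
      funext x
      by_cases hx : ‖x‖ < ε
      · simp [(hφ_zero x hx).1]
      · have h1 := (hUV x (not_lt.1 hx)).1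
        simp only [convect, h1.fderiv_eq, h1.self_of_nhds]
    have e4 : (fun x => Q x * VectorCalculus.divergence φ x) =
        fun x => P x * VectorCalculus.divergence φ x := by
      funext x
      by_cases hx : ‖x‖ < ε
      · simp [VectorCalculus.divergence, (hφ_zero x hx).2]
      · rw [show Q x = P x from (hUV x (not_lt.1 hx)).2.self_of_nhds]
    have e5 : (fun x => ⟪gradient Q x, φ x⟫) = fun x => ⟪gradient P x, φ x⟫ := by
      funext x
      by_cases hx : ‖x‖ < ε
      · simp [(hφ_zero x hx).1]
      · simp only [gradient, (hUV x (not_lt.1 hx)).2.fderiv_eq]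
    rw [e1, e2, e3] at htri
    rw [e4, e5] at hpr
    simp only [integral_zero, add_zero] at htri
    -- integrability (continuous with compact support, via the globalised versions)
    have hi1 : Integrable (fun x => ⟪V x, fderiv ℝ φ x (V x)⟫)
        (volume : Measure (EuclideanSpace ℝ (Fin 3))) := by
      rw [← e1]
      refine (hUC.continuous.inner ((hφC.continuous_fderiv one_ne_zero).clm_apply
        hUC.continuous)).integrable_of_hasCompactSupport ?_
      refine (hφc.fderiv (𝕜 := ℝ)).mono fun x hx => ?_
      contrapose! hx
      simp only [mem_support, not_not] at hx
      simp [convect, hx]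
    have hi2 : Integrable (fun x => P x * VectorCalculus.divergence φ x)
        (volume : Measure (EuclideanSpace ℝ (Fin 3))) := by
      rw [← e4]
      refine (hQC.continuous.mul (continuous_divergence (hφC.continuous_fderiv one_ne_zero)))
        |>.integrable_of_hasCompactSupport (hφc.mono' fun x hx => ?_)
      contrapose! hx
      simp only [mem_support, not_not, Pi.mul_apply]
      rw [divergence_eq_zero_of_notMem_tsupport hx, mul_zero]
    have hi3 : Integrable (fun x => ⟪convect V V x, φ x⟫)
        (volume : Measure (EuclideanSpace ℝ (Fin 3))) := by
      rw [← e3]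
      exact (((hUC.continuous_fderiv one_ne_zero).clm_apply hUC.continuous).inner
        hφC.continuous).integrable_of_hasCompactSupport
          (hφc.mono fun x hx => by contrapose! hx; simp_all)
    have hi4 : Integrable (fun x => ⟪gradient P x, φ x⟫)
        (volume : Measure (EuclideanSpace ℝ (Fin 3))) := by
      rw [← e5]
      exact ((continuous_gradient_of_contDiff hQC).inner hφC.continuous)
        |>.integrable_of_hasCompactSupport (hφc.mono fun x hx => by contrapose! hx; simp_all)
    have hw := hweak φ hφ
    rw [integral_add hi1 hi2] at hw
    have : ∫ x, ⟪convect V V x + gradient P x, φ x⟫ =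
        (∫ x, ⟪convect V V x, φ x⟫) + ∫ x, ⟪gradient P x, φ x⟫ := by
      simp_rw [inner_add_left]
      exact integral_add hi3 hi4
    rw [this]
    linarith
  -- Step 2: components, fundamental lemma, continuity
  have hcontG : ContinuousOn (fun x => convect V V x + gradient P x) {x | x ≠ 0} := by
    have hfd : ContinuousOn (fun y => fderiv ℝ V y) {x | x ≠ 0} :=
      hV.continuousOn_fderiv_of_isOpen isOpen_ne le_rfl
    have hfdP : ContinuousOn (fun y => fderiv ℝ P y) {x | x ≠ 0} :=
      hP.continuousOn_fderiv_of_isOpen isOpen_ne le_rfl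
    refine (hfd.clm_apply hV.continuousOn).add ?_
    exact (InnerProductSpace.toDual ℝ (EuclideanSpace ℝ (Fin 3))).symm.continuous.comp_continuousOn
      hfdP
  intro x hx
  ext i
  have hcomp : ContinuousOn (fun y => ⟪convect V V y + gradient P y, EuclideanSpace.single i (1 : ℝ)⟫)
      {x | x ≠ 0} := hcontG.inner continuousOn_const
  have hae : ∀ᵐ y ∂(volume : Measure (EuclideanSpace ℝ (Fin 3))),
      y ∈ {x : EuclideanSpace ℝ (Fin 3) | x ≠ 0} →
        ⟪convect V V y + gradient P y, EuclideanSpace.single i (1 : ℝ)⟫ = 0 := by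
    refine isOpen_ne.ae_eq_zero_of_integral_contDiff_smul_eq_zero
      (hcomp.locallyIntegrableOn isOpen_ne.measurableSet) fun g hg hgc hgs => ?_
    have htest : Literature.Analysis.FunctionSpaces.IsTestFunctionOn
        (⟨{x | x ≠ 0}, isOpen_ne⟩ : TopologicalSpace.Opens (EuclideanSpace ℝ (Fin 3)))
        (fun y => g y • EuclideanSpace.single i (1 : ℝ)) :=
      ⟨hg.smul contDiff_const, hgc.smul_right, (tsupport_smul_subset_left _ _).trans hgs⟩
    have h := hG _ htest
    simp_rw [real_inner_smul_right] at h
    simpa [smul_eq_mul] using h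
  have h0 := eq_zero_of_ae_of_continuousOn isOpen_ne hcomp hae x hx
  have h0' : (convect V V x + gradient P x).ofLp i = 0 := by
    simpa [EuclideanSpace.inner_single_right] using h0
  rw [h0', WithLp.ofLp_zero, Pi.zero_apply]

/-- **Witnesses of the crux are not `C¹`.** Any `(λ, V, P)` satisfying the clauses of
`PointSink.PointFluxCone` (DSS laws, weak momentum and divergence clauses, non-zero shell flux)
has `V` or `P` NOT of class `C¹` on `ℝ³ ∖ {0}`: the weak clauses make a `C¹` pair classical
(`divergence_eq_zero_of_weak`, `momentum_eq_zero_of_weak`) and `shellFlux_eq_zero_of_classical`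
kills the flux clause. [folklore] -/
theorem pointFluxCone_witness_not_contDiffOn {lam : ℝ}
    {V : EuclideanSpace ℝ (Fin 3) → EuclideanSpace ℝ (Fin 3)} {P : EuclideanSpace ℝ (Fin 3) → ℝ}
    (hlam : 1 < lam)
    (hVs : ∀ x : EuclideanSpace ℝ (Fin 3), x ≠ 0 → V (lam • x) = lam ^ (-(2 / 3 : ℝ)) • V x)
    (hPs : ∀ x : EuclideanSpace ℝ (Fin 3), x ≠ 0 → P (lam • x) = lam ^ (-(4 / 3 : ℝ)) * P x)
    (hmomw : ∀ φ : EuclideanSpace ℝ (Fin 3) → EuclideanSpace ℝ (Fin 3),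
      Literature.Analysis.FunctionSpaces.IsTestFunctionOn
        ⟨{x : EuclideanSpace ℝ (Fin 3) | x ≠ 0}, isOpen_ne⟩ φ →
      ∫ x, (inner ℝ (V x) (fderiv ℝ φ x (V x)) +
        P x * Literature.Analysis.FluidPDE.VectorCalculus.divergence φ x) = 0)
    (hdivw : ∀ θ : EuclideanSpace ℝ (Fin 3) → ℝ,
      Literature.Analysis.FunctionSpaces.IsTestFunctionOn
        ⟨{x : EuclideanSpace ℝ (Fin 3) | x ≠ 0}, isOpen_ne⟩ θ →
      ∫ x, inner ℝ (V x) (gradient θ x) = 0)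
    (hne : (∫ x in {x : EuclideanSpace ℝ (Fin 3) | 1 < ‖x‖ ∧ ‖x‖ < lam},
      (‖V x‖ ^ 2 / 2 + P x) * (inner ℝ (V x) x / ‖x‖ ^ 2)) ≠ 0) :
    ¬ (ContDiffOn ℝ 1 V {x : EuclideanSpace ℝ (Fin 3) | x ≠ 0} ∧
      ContDiffOn ℝ 1 P {x : EuclideanSpace ℝ (Fin 3) | x ≠ 0}) := by
  rintro ⟨hV, hP⟩
  have hdiv := divergence_eq_zero_of_weak hV hdivw
  have hmom := momentum_eq_zero_of_weak hV hP hdiv hmomw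
  exact hne (shellFlux_eq_zero_of_classical hlam hV hP hVs hPs hdiv hmom)

/-- **No `C¹` witness of `PointFluxCone`.** The body of the crux VERBATIM with the two extra
clauses "`V`, `P` are `C¹` on `ℝ³ ∖ {0}`" is FALSE — the roughness of a witness is LOAD-BEARING
(indeed `div (h(B) V) = 0` must fail in the bulk of every shell). [folklore] -/
theorem not_exists_pointFluxCone_contDiffOn :
    ¬ ∃ (lam : ℝ) (V : EuclideanSpace ℝ (Fin 3) → EuclideanSpace ℝ (Fin 3))
        (P : EuclideanSpace ℝ (Fin 3) → ℝ), 1 < lam ∧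
      MeasureTheory.AEStronglyMeasurable V MeasureTheory.volume ∧
      (∀ x : EuclideanSpace ℝ (Fin 3), x ≠ 0 → V (lam • x) = lam ^ (-(2 / 3 : ℝ)) • V x) ∧
      (∀ x : EuclideanSpace ℝ (Fin 3), x ≠ 0 → P (lam • x) = lam ^ (-(4 / 3 : ℝ)) * P x) ∧
      MeasureTheory.LocallyIntegrableOn (fun x => ‖V x‖ ^ 2) {x : EuclideanSpace ℝ (Fin 3) | x ≠ 0}
        MeasureTheory.volume ∧
      MeasureTheory.LocallyIntegrableOn P {x : EuclideanSpace ℝ (Fin 3) | x ≠ 0}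
        MeasureTheory.volume ∧
      (∀ φ : EuclideanSpace ℝ (Fin 3) → EuclideanSpace ℝ (Fin 3),
        Literature.Analysis.FunctionSpaces.IsTestFunctionOn
          ⟨{x : EuclideanSpace ℝ (Fin 3) | x ≠ 0}, isOpen_ne⟩ φ →
        ∫ x, (inner ℝ (V x) (fderiv ℝ φ x (V x)) +
          P x * Literature.Analysis.FluidPDE.VectorCalculus.divergence φ x) = 0) ∧
      (∀ θ : EuclideanSpace ℝ (Fin 3) → ℝ,
        Literature.Analysis.FunctionSpaces.IsTestFunctionOn
          ⟨{x : EuclideanSpace ℝ (Fin 3) | x ≠ 0}, isOpen_ne⟩ θ →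
        ∫ x, inner ℝ (V x) (gradient θ x) = 0) ∧
      MeasureTheory.IntegrableOn (fun x => (‖V x‖ ^ 2 / 2 + P x) * (inner ℝ (V x) x / ‖x‖ ^ 2))
        {x : EuclideanSpace ℝ (Fin 3) | 1 < ‖x‖ ∧ ‖x‖ < lam} MeasureTheory.volume ∧
      (∫ x in {x : EuclideanSpace ℝ (Fin 3) | 1 < ‖x‖ ∧ ‖x‖ < lam},
        (‖V x‖ ^ 2 / 2 + P x) * (inner ℝ (V x) x / ‖x‖ ^ 2)) ≠ 0 ∧
      ContDiffOn ℝ 1 V {x : EuclideanSpace ℝ (Fin 3) | x ≠ 0} ∧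
      ContDiffOn ℝ 1 P {x : EuclideanSpace ℝ (Fin 3) | x ≠ 0} := by
  rintro ⟨lam, V, P, hlam, -, hVs, hPs, -, -, hmomw, hdivw, -, hne, hV, hP⟩
  exact pointFluxCone_witness_not_contDiffOn hlam hVs hPs hmomw hdivw hne ⟨hV, hP⟩

end WeakToClassical

end Summit.AnomalousDissipation.AnomalousDissipation.Theorems.PointFluxCone.Negative
end
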